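import Summits.HubbardSuperconductivity.HubbardSuperconductivity.Theorems.AnisotropyChordInsertionEntropyJastrowL1
import Summits.HubbardSuperconductivity.HubbardSuperconductivity.Theorems.AnisotropyChordInsertionEntropyJelliumScreening

/-!
# Route `AnisotropyChord` / H0 rotor rung: the CANONICAL Jastrow–sheet chain `R8bᶜ ⇒ R8aᶜ ⇒ R8ᶜ ⇒` condensate
# floor along a sector sequence (port of theory seat `hubbard-h0-rotor-theory-1`, Sketch9 Parts I–J, memo
# ROTOR-THEORY-9 §135(h)(i), in the tree's currency: the canonical state is `jastrowSectorAmp (sheetKernel L β c) N`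
# of `…InsertionEntropyJastrowCanonical`, already normalised)

* abstract J3′ `klDiv_eq_cloud_of_eq_spectator` (any amplitude whose teleportation entropy is a mean spectator shift
  for a difference kernel sees only the screening cloud `condOcc − m`);
* translation invariance of the canonical sheet state, uniform site density, symmetric pair masses, and the
  canonical J3′ `klDiv_teleLaw_sheetSector_cloud`;
* the three canonical cruxes along a sector sequence `Nseq` — **R8ᶜ** `JelliumSheetEntropyBoundC`,
  **R8aᶜ** `SheetWeightedScreeningC`, **R8bᶜ** `SheetDefectScreeningC` (typed, OPEN) — with the amplitude-generic
  cores `klDiv_le_of_cloud_weighted`, `cloud_weighted_of_pointwise` and the PROVED implications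
  `R8bᶜ ⇒ R8aᶜ ⇒ R8ᶜ`; the `∀ N` spectator form R8c (`JelliumSheetCanonicalScreening`) implies R8ᶜ for every `Nseq`;
* ★ `condensateDensity_sheetSector_ge_of_entropyBoundC` / `…_of_defectC`: along any sector sequence,
  `R8ᶜ` (resp. `R8bᶜ`) gives `n₀/|Λ| ≥ (N_L/L²)(1 − N_L/L²)e^{−C/2}` for the canonical Jastrow–sheet state, the two
  per-volume hypotheses being a non-empty sector and a template for every ordered pair (discharged for
  `1 ≤ N_L ≤ L² − 1` in `…InsertionEntropySheetSector`).
-/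

set_option linter.dupNamespace false

noncomputable section

open Finset
open Literature.Probability.LatticeModels

namespace Summit.HubbardSuperconductivity.HubbardSuperconductivity.Theorems.AnisotropyChord.InsertionEntropy

section SheetCanonical

/-- **J3′, abstract form:** whenever `KL(ν_x^{(y)} ‖ ν_y^{(x)}) = E_{ν_x^{(y)}}[Φ(y) − Φ(x)]` for a difference kernel
`W`, the entropy equals the screening-cloud functional `Σ_z (condOcc(z) − m)(W(z−y) − W(z−x))` for every background
constant `m`. (theory seat `hubbard-h0-rotor-theory-1`, Sketch9 Part I, memo ROTOR-THEORY-9 §135) [folklore] -/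
theorem klDiv_eq_cloud_of_eq_spectator {G : Type} [AddCommGroup G] [Fintype G] [DecidableEq G]
    (W : G → ℝ) (a : (G → Fin 2) → ℝ) (x y : G) (m : ℝ)
    (hKL : klDiv (teleLaw a x y) (teleLaw a y x)
      = ∑ τ, teleLaw a x y τ * (spectatorField (fun u v => W (u - v)) τ y
          - spectatorField (fun u v => W (u - v)) τ x)) :
    klDiv (teleLaw a x y) (teleLaw a y x) = ∑ z, (condOcc a x y z - m) * (W (z - y) - W (z - x)) := by
  rw [hKL]
  unfold spectatorField condOcc
  have step : ∑ τ, teleLaw a x y τ * (∑ z, occ τ z * W (z - y) - ∑ z, occ τ z * W (z - x))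
      = ∑ z, (∑ τ, teleLaw a x y τ * occ τ z) * (W (z - y) - W (z - x)) := by
    calc ∑ τ, teleLaw a x y τ * (∑ z, occ τ z * W (z - y) - ∑ z, occ τ z * W (z - x))
        = ∑ τ, ∑ z, teleLaw a x y τ * occ τ z * (W (z - y) - W (z - x)) := by
          refine Finset.sum_congr rfl fun τ _ => ?_
          rw [← Finset.sum_sub_distrib, Finset.mul_sum]
          refine Finset.sum_congr rfl fun z _ => ?_
          ring
      _ = ∑ z, ∑ τ, teleLaw a x y τ * occ τ z * (W (z - y) - W (z - x)) := Finset.sum_comm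
      _ = ∑ z, (∑ τ, teleLaw a x y τ * occ τ z) * (W (z - y) - W (z - x)) := by
          refine Finset.sum_congr rfl fun z _ => ?_
          rw [Finset.sum_mul]
  rw [step]
  have h0 := sum_sub_kernel_eq W x y
  have : ∑ z, ((∑ τ, teleLaw a x y τ * occ τ z) - m) * (W (z - y) - W (z - x))
      = ∑ z, (∑ τ, teleLaw a x y τ * occ τ z) * (W (z - y) - W (z - x)) - m * ∑ z, (W (z - y) - W (z - x)) := by
    rw [Finset.mul_sum, ← Finset.sum_sub_distrib]
    refine Finset.sum_congr rfl fun z _ => ?_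
    ring
  rw [this, h0, mul_zero, sub_zero]

/-- The sheet kernel is translation invariant. (theory seat Sketch9 Part N) [folklore] -/
theorem sheetKernel_add_right (L : ℕ) [NeZero L] (β c : ℝ) (t u v : TorusSite 2 L) :
    sheetKernel L β c (u + t) (v + t) = sheetKernel L β c u v := by
  rw [sheetKernel_eq_sheetFun, sheetKernel_eq_sheetFun, add_sub_add_right_eq_sub]

/-- The canonical Jastrow–sheet amplitude is translation invariant. [folklore] -/
theorem jastrowSectorAmp_sheet_comp_addRight (L : ℕ) [NeZero L] (β c : ℝ) (N : ℕ) (t : TorusSite 2 L)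
    (σ : TorusSite 2 L → Fin 2) :
    jastrowSectorAmp (sheetKernel L β c) N (σ ∘ Equiv.addRight t) = jastrowSectorAmp (sheetKernel L β c) N σ :=
  jastrowSectorAmp_comp_equiv _ N (Equiv.addRight t) (fun u v => sheetKernel_add_right L β c t u v) σ

/-- **Homogeneity:** the site density of the canonical Jastrow–sheet state is the same at every site. [folklore] -/
theorem siteDensity_sheetSector_eq (L : ℕ) [NeZero L] (β c : ℝ) (N : ℕ) (x : TorusSite 2 L) :
    siteDensity (jastrowSectorAmp (sheetKernel L β c) N) x = siteDensity (jastrowSectorAmp (sheetKernel L β c) N) 0 := by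
  have h := siteDensity_comp_equiv (Equiv.addRight x) (jastrowSectorAmp (sheetKernel L β c) N)
    (jastrowSectorAmp_sheet_comp_addRight L β c N x) 0
  have h0 : (Equiv.addRight x) (0 : TorusSite 2 L) = x := by simp
  rw [h0] at h
  exact h

/-- Symmetric pair masses `a_{xy} = a_{yx}` of the canonical Jastrow–sheet state (uniform density). [folklore] -/
theorem pairMass_symm_sheetSector (L : ℕ) [NeZero L] (β c : ℝ) (N : ℕ) (x y : TorusSite 2 L) :
    pairMass (jastrowSectorAmp (sheetKernel L β c) N) x y = pairMass (jastrowSectorAmp (sheetKernel L β c) N) y x :=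
  pairMass_symm_of_siteDensity _ _ (siteDensity_sheetSector_eq L β c N) x y

/-- **Canonical J3′ for the sheet (PROVED):** for the `N`-particle Jastrow–sheet state (non-empty sector),
`KL(ν_x^{(y)} ‖ ν_y^{(x)}) = Σ_z (condOcc(z) − m)(W(z−y) − W(z−x))` for every background `m`.
(theory seat Sketch9 Part I `klDiv_teleLaw_sheetSector_cloud`) [folklore] -/
theorem klDiv_teleLaw_sheetSector_cloud (L : ℕ) [NeZero L] (β c : ℝ) (N : ℕ)
    (hZ : 0 < jastrowSectorWeight (sheetKernel L β c) N) (x y : TorusSite 2 L) (m : ℝ) :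
    klDiv (teleLaw (jastrowSectorAmp (sheetKernel L β c) N) x y) (teleLaw (jastrowSectorAmp (sheetKernel L β c) N) y x)
      = ∑ z, (condOcc (jastrowSectorAmp (sheetKernel L β c) N) x y z - m)
          * (sheetFun L β c (z - y) - sheetFun L β c (z - x)) := by
  have h := klDiv_teleLaw_jastrowSector (sheetKernel L β c) (sheetKernel_symm L β c) N hZ x y
    (sheetKernel_diag L β c x y) (pairMass_symm_sheetSector L β c N y x)
  rw [sheetKernel_eq_fun] at h ⊢
  exact klDiv_eq_cloud_of_eq_spectator (sheetFun L β c) _ x y m h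

/-- **R8ᶜ — `JelliumSheetEntropyBoundC β c Nseq` (canonical jellium-sheet entropy bound along a sector sequence;
OPEN):** the teleportation entropies of the canonical Jastrow–sheet state with `Nseq L` particles on `(ℤ/L)²` are
bounded uniformly in `L` and in the ordered pair (whenever the pair admits a template).
[conjecture: theory seat hubbard-h0-rotor-theory-1, cycle 9, 2026-08-28 — Sketch9 Part I, memo ROTOR-THEORY-9 §135(i) (R8ᶜ; OPEN)] -/
def JelliumSheetEntropyBoundC (β c : ℝ) (Nseq : ℕ → ℕ) : Prop :=
  ∃ C : ℝ, ∀ L : ℕ, ∀ [NeZero L], ∀ x y : TorusSite 2 L, x ≠ y →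
    0 < pairMass (jastrowSectorAmp (sheetKernel L β c) (Nseq L)) x y →
    klDiv (teleLaw (jastrowSectorAmp (sheetKernel L β c) (Nseq L)) x y)
      (teleLaw (jastrowSectorAmp (sheetKernel L β c) (Nseq L)) y x) ≤ C

/-- **R8aᶜ — `SheetWeightedScreeningC β c Nseq` (weighted screening of the CANONICAL two-defect cloud; OPEN).**
[conjecture: theory seat hubbard-h0-rotor-theory-1, cycle 9, 2026-08-28 — Sketch9 Part I, memo ROTOR-THEORY-9 §135(i) (R8aᶜ; OPEN)] -/
def SheetWeightedScreeningC (β c : ℝ) (Nseq : ℕ → ℕ) : Prop :=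
  ∃ C : ℝ, ∀ L : ℕ, ∀ [NeZero L], ∀ x y : TorusSite 2 L, x ≠ y → ∃ m : ℝ,
    ∑ z, |condOcc (jastrowSectorAmp (sheetKernel L β c) (Nseq L)) x y z - m|
        * (|sheetFun L β c (z - y)| + |sheetFun L β c (z - x)|) ≤ C

/-- **R8bᶜ — `SheetDefectScreeningC β c Nseq` (pointwise algebraic screening of the CANONICAL two-defect cloud,
i.e. of the three-point truncated correlation of the canonical lattice `β/r` sheet gas with `Nseq L` particles;
OPEN):** `|condOcc(z) − m| ≤ C[(1+d(z,x))^{−1−ε} + (1+d(z,y))^{−1−ε}]` for some `ε > 0`, uniformly in `L`, `x ≠ y`.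
[conjecture: theory seat hubbard-h0-rotor-theory-1, cycle 9, 2026-08-28 — Sketch9 Part I, memo ROTOR-THEORY-9 §135(i) (R8bᶜ; OPEN)] -/
def SheetDefectScreeningC (β c : ℝ) (Nseq : ℕ → ℕ) : Prop :=
  ∃ C ε : ℝ, 0 < ε ∧ ∀ L : ℕ, ∀ [NeZero L], ∀ x y : TorusSite 2 L, x ≠ y → ∃ m : ℝ, ∀ z : TorusSite 2 L,
    |condOcc (jastrowSectorAmp (sheetKernel L β c) (Nseq L)) x y z - m|
      ≤ C * (latWeight L (1 + ε) (z - x) + latWeight L (1 + ε) (z - y))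

/-- A positive pair mass forces a non-empty sector (`Z_N > 0`). [folklore] -/
theorem jastrowSectorWeight_pos_of_pairMass_pos {V : Type} [Fintype V] [DecidableEq V] (w : V → V → ℝ) (N : ℕ)
    (x y : V) (h : 0 < pairMass (jastrowSectorAmp w N) x y) : 0 < jastrowSectorWeight w N := by
  rcases eq_or_lt_of_le (jastrowSectorWeight_nonneg w N) with h0 | hpos
  · exfalso
    have hzero : ∀ σ, jastrowSectorAmp w N σ = 0 := by
      intro σ
      unfold jastrowSectorAmp
      split_ifs
      · rw [← h0, Real.sqrt_zero, div_zero]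
      · rfl
    have : pairMass (jastrowSectorAmp w N) x y = 0 := by
      unfold pairMass
      refine Finset.sum_eq_zero fun τ _ => ?_
      split_ifs
      · rw [hzero]; ring
      · rfl
    rw [this] at h
    exact lt_irrefl 0 h
  · exact hpos

/-- **R8c ⇒ R8ᶜ for every sector sequence (PROVED link):** the `∀ N` canonical spectator-shift bound
`JelliumSheetCanonicalScreening` of `…InsertionEntropyJastrowCanonical` implies the entropy bound along any `Nseq`
(canonical J2). [folklore] -/
theorem jelliumSheetEntropyBoundC_of_canonicalScreening (β c : ℝ) (h : JelliumSheetCanonicalScreening β c)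
    (Nseq : ℕ → ℕ) : JelliumSheetEntropyBoundC β c Nseq := by
  obtain ⟨C, hC⟩ := h
  refine ⟨C, fun L _ x y hxy hM => ?_⟩
  have hZ := jastrowSectorWeight_pos_of_pairMass_pos _ _ x y hM
  rw [klDiv_teleLaw_jastrowSector (sheetKernel L β c) (sheetKernel_symm L β c) (Nseq L) hZ x y
    (sheetKernel_diag L β c x y) (pairMass_symm_sheetSector L β c (Nseq L) y x)]
  exact hC L (Nseq L) hZ x y hxy

/-- Core of «weighted ⇒ entropy», generic in the amplitude. (theory seat Sketch9 Part I) [folklore] -/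
theorem klDiv_le_of_cloud_weighted {L : ℕ} [NeZero L] (β c : ℝ) (a : (TorusSite 2 L → Fin 2) → ℝ)
    (x y : TorusSite 2 L) (m C : ℝ)
    (hcloud : klDiv (teleLaw a x y) (teleLaw a y x)
      = ∑ z, (condOcc a x y z - m) * (sheetFun L β c (z - y) - sheetFun L β c (z - x)))
    (hw : ∑ z, |condOcc a x y z - m| * (|sheetFun L β c (z - y)| + |sheetFun L β c (z - x)|) ≤ C) :
    klDiv (teleLaw a x y) (teleLaw a y x) ≤ C := by
  rw [hcloud]
  refine le_trans (Finset.sum_le_sum fun z _ => ?_) hw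
  calc (condOcc a x y z - m) * (sheetFun L β c (z - y) - sheetFun L β c (z - x))
        ≤ |(condOcc a x y z - m) * (sheetFun L β c (z - y) - sheetFun L β c (z - x))| := le_abs_self _
    _ = |condOcc a x y z - m| * |sheetFun L β c (z - y) - sheetFun L β c (z - x)| := abs_mul _ _
    _ ≤ |condOcc a x y z - m| * (|sheetFun L β c (z - y)| + |sheetFun L β c (z - x)|) :=
        mul_le_mul_of_nonneg_left (abs_sub _ _) (abs_nonneg _)

/-- Core of «pointwise ⇒ weighted», generic in the amplitude: the cross-term comparison `latWeight_mul_le` and a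
uniform lattice sum `Σ_z (1+d(z))^{−2−ε} ≤ S`. (theory seat Sketch9 Part I) [folklore] -/
theorem cloud_weighted_of_pointwise {L : ℕ} [NeZero L] (β c : ℝ) (a : (TorusSite 2 L → Fin 2) → ℝ)
    (x y : TorusSite 2 L) (m C ε S : ℝ) (hε : 0 < ε) (hC : 0 ≤ C)
    (hS : ∑ z : TorusSite 2 L, latWeight L (2 + ε) z ≤ S)
    (hm : ∀ z, |condOcc a x y z - m| ≤ C * (latWeight L (1 + ε) (z - x) + latWeight L (1 + ε) (z - y))) :
    ∑ z, |condOcc a x y z - m| * (|sheetFun L β c (z - y)| + |sheetFun L β c (z - x)|)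
      ≤ 3 * C * (|c| + 2 * |β|) * (S + S) := by
  set K : ℝ := |c| + 2 * |β| with hK
  have hK0 : 0 ≤ K := by positivity
  set A : TorusSite 2 L → TorusSite 2 L → ℝ := fun u z => latWeight L (1 + ε) (z - u) with hA
  set B : TorusSite 2 L → TorusSite 2 L → ℝ := fun u z => latWeight L 1 (z - u) with hB
  set Q : TorusSite 2 L → TorusSite 2 L → ℝ := fun u z => latWeight L (2 + ε) (z - u) with hQ
  have hW : ∀ z, |sheetFun L β c (z - y)| + |sheetFun L β c (z - x)| ≤ K * (B x z + B y z) := by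
    intro z
    have h1 := abs_sheetFun_le L β c (z - y)
    have h2 := abs_sheetFun_le L β c (z - x)
    simp only [hB]; linarith
  have hcross : ∀ z, (A x z + A y z) * (B x z + B y z) ≤ 3 * (Q x z + Q y z) := by
    intro z
    have e1 : (1 + ε) + 1 = 2 + ε := by ring
    have hxx : A x z * B x z = Q x z := by simp only [hA, hB, hQ]; rw [latWeight_mul, e1]
    have hyy : A y z * B y z = Q y z := by simp only [hA, hB, hQ]; rw [latWeight_mul, e1]
    have hxy' : A x z * B y z ≤ Q x z + Q y z := by
      simp only [hA, hB, hQ]; rw [← e1]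
      exact latWeight_mul_le L (by linarith) zero_le_one (z - x) (z - y)
    have hyx' : A y z * B x z ≤ Q y z + Q x z := by
      simp only [hA, hB, hQ]; rw [← e1]
      exact latWeight_mul_le L (by linarith) zero_le_one (z - y) (z - x)
    nlinarith [hxx, hyy, hxy', hyx', latWeight_nonneg L (2 + ε) (z - x), latWeight_nonneg L (2 + ε) (z - y)]
  have hterm : ∀ z, |condOcc a x y z - m| * (|sheetFun L β c (z - y)| + |sheetFun L β c (z - x)|)
      ≤ 3 * C * K * (Q x z + Q y z) := by
    intro z
    have hb0 : 0 ≤ C * (A x z + A y z) :=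
      mul_nonneg hC (add_nonneg (latWeight_nonneg L _ _) (latWeight_nonneg L _ _))
    calc |condOcc a x y z - m| * (|sheetFun L β c (z - y)| + |sheetFun L β c (z - x)|)
          ≤ (C * (A x z + A y z)) * (K * (B x z + B y z)) :=
            mul_le_mul (hm z) (hW z) (add_nonneg (abs_nonneg _) (abs_nonneg _)) hb0
      _ = C * K * ((A x z + A y z) * (B x z + B y z)) := by ring
      _ ≤ C * K * (3 * (Q x z + Q y z)) := mul_le_mul_of_nonneg_left (hcross z) (mul_nonneg hC hK0)
      _ = 3 * C * K * (Q x z + Q y z) := by ring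
  have hsumQ : ∑ z, (Q x z + Q y z) ≤ S + S := by
    rw [Finset.sum_add_distrib]
    simp only [hQ]
    rw [sum_latWeight_sub L (2 + ε) x, sum_latWeight_sub L (2 + ε) y]
    exact add_le_add hS hS
  calc ∑ z, |condOcc a x y z - m| * (|sheetFun L β c (z - y)| + |sheetFun L β c (z - x)|)
        ≤ ∑ z, 3 * C * K * (Q x z + Q y z) := Finset.sum_le_sum fun z _ => hterm z
    _ = 3 * C * K * ∑ z, (Q x z + Q y z) := by rw [Finset.mul_sum]
    _ ≤ 3 * C * K * (S + S) := mul_le_mul_of_nonneg_left hsumQ (by positivity)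

/-- **R8ᶜ ⟸ R8aᶜ (PROVED).** (theory seat Sketch9 Part I) [folklore] -/
theorem jelliumSheetEntropyBoundC_of_weighted (β c : ℝ) (Nseq : ℕ → ℕ) :
    SheetWeightedScreeningC β c Nseq → JelliumSheetEntropyBoundC β c Nseq := by
  rintro ⟨C, h⟩
  refine ⟨C, fun L _ x y hxy hM => ?_⟩
  obtain ⟨m, hm⟩ := h L x y hxy
  have hZ := jastrowSectorWeight_pos_of_pairMass_pos _ _ x y hM
  exact klDiv_le_of_cloud_weighted β c _ x y m C (klDiv_teleLaw_sheetSector_cloud L β c (Nseq L) hZ x y m) hm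

/-- **R8aᶜ ⟸ R8bᶜ (PROVED).** (theory seat Sketch9 Part I) [folklore] -/
theorem sheetWeightedScreeningC_of_defect (β c : ℝ) (Nseq : ℕ → ℕ) :
    SheetDefectScreeningC β c Nseq → SheetWeightedScreeningC β c Nseq := by
  rintro ⟨C, ε, hε, h⟩
  obtain ⟨S, hS⟩ := sum_latWeight_le (q := 2 + ε) (by linarith)
  refine ⟨3 * (max C 0) * (|c| + 2 * |β|) * (S + S), fun L _ x y hxy => ?_⟩
  obtain ⟨m, hm⟩ := h L x y hxy
  refine ⟨m, cloud_weighted_of_pointwise β c _ x y m (max C 0) ε S hε (le_max_right _ _) (hS L) ?_⟩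
  intro z
  exact (hm z).trans (mul_le_mul_of_nonneg_right (le_max_left _ _)
    (add_nonneg (latWeight_nonneg L _ _) (latWeight_nonneg L _ _)))

/-- **THE CANONICAL JASTROW–SHEET CHAIN (PROVED):** `R8bᶜ ⇒ R8aᶜ ⇒ R8ᶜ`. (theory seat Sketch9 Part I) [folklore] -/
theorem jelliumSheetEntropyBoundC_of_defect (β c : ℝ) (Nseq : ℕ → ℕ) :
    SheetDefectScreeningC β c Nseq → JelliumSheetEntropyBoundC β c Nseq :=
  fun h => jelliumSheetEntropyBoundC_of_weighted β c Nseq (sheetWeightedScreeningC_of_defect β c Nseq h)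

/-- **★ (PROVED): `R8ᶜ ⇒` condensate floor for the canonical Jastrow–sheet state along any sector sequence.**
`n₀/|Λ| ≥ (N_L/L²)(1 − N_L/L²)·e^{−C/2}` with `C` independent of `L`; per-volume hypotheses: non-empty sector and a
template for every ordered pair.  One-state E-floor + uniform density + canonical J2/J3′.
(theory seat Sketch9 Part J/O `condensate_floor_of_entropyBoundC`) [folklore] -/
theorem condensateDensity_sheetSector_ge_of_entropyBoundC (β c : ℝ) (Nseq : ℕ → ℕ)
    (h : JelliumSheetEntropyBoundC β c Nseq) :
    ∃ C : ℝ, ∀ L : ℕ, ∀ [NeZero L], 0 < jastrowSectorWeight (sheetKernel L β c) (Nseq L) →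
      (∀ x y : TorusSite 2 L, x ≠ y → 0 < pairMass (jastrowSectorAmp (sheetKernel L β c) (Nseq L)) x y) →
      ((Nseq L : ℝ) / (L : ℝ) ^ 2) * (1 - (Nseq L : ℝ) / (L : ℝ) ^ 2) * Real.exp (-C / 2)
        ≤ condensateDensity (jastrowSectorAmp (sheetKernel L β c) (Nseq L)) := by
  obtain ⟨C, hC⟩ := h
  refine ⟨C, fun L _ hZ hM => ?_⟩
  set a := jastrowSectorAmp (sheetKernel L β c) (Nseq L) with ha
  have hsect : ∀ σ, a σ ≠ 0 → ((univ.filter fun z => σ z = 0).card : ℝ) = (Nseq L : ℝ) := by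
    intro σ hσ
    exact_mod_cast particleCount_eq_of_jastrowSectorAmp_ne_zero _ _ σ hσ
  have main := condensateDensity_ge_of_teleEntropy' a (Nseq L : ℝ) (siteDensity a 0) C
    (jastrowSectorAmp_nonneg _ _) (sum_jastrowSectorAmp_sq _ _ hZ) hsect (siteDensity_sheetSector_eq L β c (Nseq L))
    (fun x y τ _ hτ => teleLaw_jastrowSector_pos_symm _ _ hZ x y τ hτ) (fun x y hxy => hC L x y hxy (hM x y hxy))
  have hcard : (Fintype.card (TorusSite 2 L) : ℝ) = (L : ℝ) ^ 2 := by
    rw [Fintype.card_fun, ZMod.card, Fintype.card_fin]; push_cast; ring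
  rw [hcard] at main
  exact main

/-- **★ from R8bᶜ (PROVED):** `SheetDefectScreeningC β c Nseq ⇒` the same condensate floor.
(theory seat Sketch9 Part J `condensate_floor_of_sheetDefectScreeningC`) [folklore] -/
theorem condensateDensity_sheetSector_ge_of_defectC (β c : ℝ) (Nseq : ℕ → ℕ)
    (h : SheetDefectScreeningC β c Nseq) :
    ∃ C : ℝ, ∀ L : ℕ, ∀ [NeZero L], 0 < jastrowSectorWeight (sheetKernel L β c) (Nseq L) →
      (∀ x y : TorusSite 2 L, x ≠ y → 0 < pairMass (jastrowSectorAmp (sheetKernel L β c) (Nseq L)) x y) →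
      ((Nseq L : ℝ) / (L : ℝ) ^ 2) * (1 - (Nseq L : ℝ) / (L : ℝ) ^ 2) * Real.exp (-C / 2)
        ≤ condensateDensity (jastrowSectorAmp (sheetKernel L β c) (Nseq L)) :=
  condensateDensity_sheetSector_ge_of_entropyBoundC β c Nseq (jelliumSheetEntropyBoundC_of_defect β c Nseq h)

end SheetCanonical

end Summit.HubbardSuperconductivity.HubbardSuperconductivity.Theorems.AnisotropyChord.InsertionEntropy
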